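import Summits.Ventures.PercRepro.S1TriangleKernelSixLemmas

/-!
# PercRepro — THE TRIANGLE KERNEL AT NULLITY `6`: THE RESTRICTION STEP (p8, gen 24; a feeder for S4 — the rows
`≤ 36` of the `q = 7` window)

With `s₃ = 11` at nullity `6` and `7 ≤ |U| ≤ 11` for `U = ⋃ triangles`: the restriction `M ↾ U` has the same
triangles, so its nullity `d_U` has `11 ≤ triBound8 d_U`, i.e. `d_U ≥ 6`; `r(U) ≥ 4` by (C2) and `r(U) ≥ 5` by (C3)
once `|U| ≥ 11`; hence `|U| = 10`, or `|U| = 11` with `r(U) = 5` (`ncard_sUnion_triangles_of_eleven`).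
Axioms: standard.
-/

open scoped Matroid

namespace PercRepro

namespace S1

open Set

variable {α : Type}

/-- **The restriction step at nullity `6`.** If `s₃ = 11` and `7 ≤ |U| ≤ 11` for `U = ⋃ triangles`, then `|U| = 10`, or
`|U| = 11` and `r(U) = 5`: the restriction `M ↾ U` has the same triangles, so its nullity `d_U` has `11 ≤ triBound8 d_U`,
i.e. `d_U ≥ 6`; `r(U) ≥ 4` by (C2) and `r(U) ≥ 5` by (C3) once `|U| ≥ 11`. -/
theorem ncard_sUnion_triangles_of_eleven (M : Matroid α) [M.Finite]
    (hC1 : ∀ L ⊆ M.E, M.eRk L = 2 → L.ncard ≤ 3)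
    (hC2 : ∀ X ⊆ M.E, M.eRk X ≤ 3 → X.ncard ≤ 6)
    (hC3 : ∀ X ⊆ M.E, M.eRk X ≤ 4 → X.ncard ≤ 10)
    (hs11 : (ThmN.triangles M).ncard = 11) (hU7 : 7 ≤ (⋃₀ ThmN.triangles M).ncard)
    (hU11 : (⋃₀ ThmN.triangles M).ncard ≤ 11) :
    (⋃₀ ThmN.triangles M).ncard = 10 ∨
      ((⋃₀ ThmN.triangles M).ncard = 11 ∧ M.eRk (⋃₀ ThmN.triangles M) = 5) := by
  classical
  have hUE : ⋃₀ ThmN.triangles M ⊆ M.E := by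
    intro z hz
    obtain ⟨C, hC, hzC⟩ := Set.mem_sUnion.1 hz
    exact hC.1.subset_ground hzC
  have hUfin : (⋃₀ ThmN.triangles M).Finite := M.ground_finite.subset hUE
  set R := M ↾ (⋃₀ ThmN.triangles M) with hR
  haveI hRfinite : R.Finite := _root_.Matroid.restrict_finite hUfin
  have hRtri : ThmN.triangles R = ThmN.triangles M := by
    ext C
    show R.IsCircuit C ∧ C.ncard = 3 ↔ M.IsCircuit C ∧ C.ncard = 3
    rw [hR, _root_.Matroid.restrict_isCircuit_iff hUE]
    constructor
    · rintro ⟨⟨hC, -⟩, h3⟩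
      exact ⟨hC, h3⟩
    · rintro ⟨hC, h3⟩
      exact ⟨⟨hC, fun z hz => Set.mem_sUnion.2 ⟨C, ⟨hC, h3⟩, hz⟩⟩, h3⟩
  have hRC1 : ∀ L ⊆ R.E, R.eRk L = 2 → L.ncard ≤ 3 := by
    intro L hL hr
    rw [hR, _root_.Matroid.restrict_ground_eq] at hL
    rw [hR, _root_.Matroid.restrict_eRk_eq M hL] at hr
    exact hC1 L (hL.trans hUE) hr
  have hRC2 : ∀ X ⊆ R.E, R.eRk X ≤ 3 → X.ncard ≤ 6 := by
    intro X hX hr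
    rw [hR, _root_.Matroid.restrict_ground_eq] at hX
    rw [hR, _root_.Matroid.restrict_eRk_eq M hX] at hr
    exact hC2 X (hX.trans hUE) hr
  have hRC3 : ∀ X ⊆ R.E, R.eRk X ≤ 4 → X.ncard ≤ 10 := by
    intro X hX hr
    rw [hR, _root_.Matroid.restrict_ground_eq] at hX
    rw [hR, _root_.Matroid.restrict_eRk_eq M hX] at hr
    exact hC3 X (hX.trans hUE) hr
  have hRfin : R✶.eRank ≠ ⊤ := PercRepro.Matroid.eRank_ne_top_of_finite R✶
  obtain ⟨dU, hdU⟩ := ENat.ne_top_iff_exists.1 hRfin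
  have hdUenc : R.E.encard = R.eRank + dU := by
    have h := _root_.Matroid.eRank_add_eRank_dual R
    rw [← hdU] at h
    exact h.symm
  have hRbound := ncard_triangles_le_triBound8 R hRC1 hRC2 hRC3 hdUenc
  rw [hRtri, hs11] at hRbound
  have hdU6 : 6 ≤ dU := by
    by_contra h
    push Not at h
    have h8 : triBound8 dU ≤ 8 := by
      interval_cases dU <;> decide
    omega
  have hrfin : M.eRk (⋃₀ ThmN.triangles M) ≠ ⊤ := by
    intro h
    have := M.eRk_le_encard (⋃₀ ThmN.triangles M)
    rw [h] at this
    exact hUfin.encard_lt_top.ne (top_le_iff.1 this)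
  obtain ⟨r, hr⟩ := ENat.ne_top_iff_exists.1 hrfin
  have hnat : (⋃₀ ThmN.triangles M).ncard = r + dU := by
    have h := hdUenc
    rw [hR, _root_.Matroid.restrict_ground_eq, _root_.Matroid.eRank_restrict, ← hr,
      ← hUfin.cast_ncard_eq] at h
    exact_mod_cast h
  have hr4 : 4 ≤ r := by
    by_contra h
    push Not at h
    have h3 : M.eRk (⋃₀ ThmN.triangles M) ≤ 3 := by
      rw [← hr]
      exact_mod_cast (show r ≤ 3 by omega)
    have := hC2 _ hUE h3
    omega
  have hr5 : 11 ≤ (⋃₀ ThmN.triangles M).ncard → 5 ≤ r := by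
    intro h11
    by_contra h
    push Not at h
    have h4 : M.eRk (⋃₀ ThmN.triangles M) ≤ 4 := by
      rw [← hr]
      exact_mod_cast (show r ≤ 4 by omega)
    have := hC3 _ hUE h4
    omega
  rcases Nat.lt_or_ge (⋃₀ ThmN.triangles M).ncard 11 with hlt | hge
  · left; omega
  · right
    refine ⟨by omega, ?_⟩
    have h5 := hr5 hge
    have hr5' : r = 5 := by omega
    rw [← hr, hr5']
    rfl

end S1

end PercRepro
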